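import Literature.MathematicalPhysics.QuantumFieldTheory.Balaban1983to89.BlockAveragingZd
import Literature.MathematicalPhysics.QuantumFieldTheory.Balaban1983to89.Node00.TorusCoverLevels
import Literature.MathematicalPhysics.QuantumFieldTheory.Balaban1983to89.Node00.TorusCoverGaugeLift
import Literature.MathematicalPhysics.QuantumFieldTheory.Balaban1983to89.Node00.DatumAvLayer

/-!
# NODE 00 — THE TORUS→`ℤᵈ` TWIN, FILE 39: the COVER-LIFT DICTIONARY for the record's (0.4) block averaging — NODE 00's torus objects
# `loopHol ∕ Small ∕ axialAvg ∕ avgFun expMeanLogSU ∕ Averaging.iter (blockAvg expMeanLogSU) = Averaging.iter (avOfRecord F N K)` ARE, read through the level-`j`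
# covers `π_j = coverAt P j` under `ιSU : SU(N) →* M_N(ℂ)ˣ`, the `ℤᵈ` transcription `WZ ∕ SmallZ ∕ hol · (seg κ L) ∕ bavgZG ∕ avgIterZG` of `BlockAveragingZd`
# ([Balaban1987RG1] (0.3)–(0.4), (0.11)), with the TOP-ANCHORED centre-shift bookkeeping `ctrShift L i = (Lⁱ − 1)∕2`

Cell `pub-ymgap`, width seat `pub-ymgap-dag-n07-w3` generation 9 (the torus push-down lineage of N07's S3 item: `Node00/TorusCover*` g0–g8, S1ᶜ `…N07Thm4RecordStructure`), item
R7a of the «N05-REC» road (director-ym №254∕№255, plan g90 SIZING WORD 2026-08-29; LEAD PEN dag-n05-e: `N05-REC-LEAD.md` §2 (T4) «SU(N) ∕ `expMeanLogSU`'s radius `δ_N` enter only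
at R7 (under `ιSU`)», R0a's header «DICTIONARY to the torus record (the identification is the road's item R7, NOT claimed here): … `bavgZG δ_N ↔ avgFun expMeanLogSU`,
`avgIterZG ↔ Averaging.iter (avOfRecord F N K)`»).  THIS FILE IS THAT IDENTIFICATION, kernel-checked.  `--kind proof --supports stmt-QuantumFields-20541` (K0⁷; count-neutral;
THEOREMS ONLY — 0 `def`: the lifts are written as the displayed lambdas `fun x μ => ιSU N (U ⟨coverAt P j x, μ⟩)`, = `TorusCoverGaugeLift.zdLift N U` at `j = 0` by `rfl`).
CONSUMED BY NAME, nothing modified: dag-n05-e's `BlockAveragingZd` (p690042: `offZ IdxZ ctrShift WZ SmallZ XZ bavgZ bavgZG avgIterZ avgIterZG`, `ctrShift_succ`,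
`bavgZG_eq_bavgZ_of_small`), NODE 00's `BlockAveraging` (`Idx off loopHol Small corr avgFun blockAvg`, `LoopAverage.avg ∕ enum`, `T4Continuum.axialAvg_eq_holAt_walk`),
`BlockAveragingExpMeanLog` (`expMeanLogSU ESU eml deltaSU`, `coe_ESU_of_small`, `eml_eq_exp_sum`), `DatumAvLayer.avOfRecord`, dag-n07-e's `TorusCoverLevels` (`coverAt`,
`emb_coverAt`) and `TorusCoverGaugeLift` (`zdLift`), `Record11.ιSU ∕ coe_ιSU`, n05-a's `B7Prop1Explicit` (`hol stepHol seg expUnit`), `B7Prop2Explicit.rescale`.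
[I] = [Balaban1987RG1]; [3] = [Balaban1985Averaging]; [B5] = [Balaban1984PropagatorsI].

WHY.  N07's knit of record carries ONE conditional premise `HThm4Rec` = «[6] Thm 4 ∕ Prop. 6 for the record's own (0.4) averaging structure» (p688375); its discharge road N05-REC
re-runs the [3]∕[6] engine over dag-n05-e's `ℤᵈ` transcription `bavgZ ∕ avgIterZ` of the record's CENTRED, SYMMETRISED, GUARDED block averaging, and its last item R7 pushes the
`ℤᵈ` conclusion down to the torus objects of `HThm4Rec` (`Averaging.iter (avOfRecord F N K)`, `NrmOfRecordWide`, the (152)∕(153) letters) through the universal cover — this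
lineage's pattern (`TorusCoverLandau153Tower∕…TowerMember∕…TowerWindow`).  Every such push-down needs, FIRST, that the `ℤᵈ` transcription evaluated on the periodic lift of a
torus field IS the torus averaging of record, level by level.  The two typings differ in exactly two bookkeeping conventions, both settled here once and for all: (i) NODE 00
indexes the inner operation through a fixed enumeration `LoopAverage.enum` of `Idx P` (uniform mean ⇒ reindexing-invariant, `Fintype.sum_equiv`), the transcription sums over
`IdxZ d L = Idx P` directly; (ii) ANCHORING ((T2) of the LEAD brief): the transcription's recursion (43) `rescale L` bases the block of the coarse site `z` at `L·z` (level-`k`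
blocks CENTRED at `Lᵏz`), NODE 00's `emb y = L·y + (L−1)∕2` centres them at `Lᵏz + (Lᵏ−1)∕2` — so the level-`j` cover must be read at `w + (L^{k−j}−1)∕2·𝟙` when the finest
lift is anchored at `(Lᵏ−1)∕2·𝟙` (top-anchored: shift-free AT THE TOP level `k`, where Theorem 4's objects live), and the induction step's base-point row is exactly
`emb_coverAt` + `ctrShift_succ` (`(Lⁱ⁺¹−1)∕2 = L·(Lⁱ−1)∕2 + (L−1)∕2`, `L` odd).

WHAT IS PROVED (kernel; every `Params`, every `N ≥ 1`; standing range `k ≤ m + K` for the iterated rows; NO estimate of [3]∕[6]∕[I] — bookkeeping between two typings).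
§1 `coverAt_add_e ∕ coverAt_sub_e` (`π_j (x ± e_μ) = (π_j x) ± e_μ`), ★ `hol_coverLift_eq_holAt_walk` (ANY group: `hol (U ∘ π_j) x w = 𝒰(walk (π_j x) w)(U)`), `hol_map`
   (`hol` commutes with bondwise group homomorphisms).
§2 at a base point `q` over the block centre, `π_j q = emb c₋`: `hol_ιSU_coverLift`, ★ `WZ_coverLift_eq_loopHol` (`WZ = ι ∘ loopHol`), ★ `smallZ_coverLift_iff_small`
   (`SmallZ δ_N ↔ Small expMeanLogSU`; `dist1 = ‖·−1‖`, same `L²`-operator norm, `rfl`), `hol_seg_coverLift_eq_axialAvg` (`V([q,q+Le_κ]) = ι(U(c))`), `XZ_coverLift_eq`,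
   `coe_expMeanLogSU_avg_of_small` (on the guard `expMeanLogSU.avg W = exp[Σ_i |I|⁻¹ log W_i]` over the whole index type), ★★ `bavgZG_coverLift_eq_avgFun`
   (`bavgZG L δ_N (ι∘U∘π_j) q c.dir = ι(avgFun expMeanLogSU U c)` — on AND off the guard), `bavgZ_coverLift_eq_avgFun_of_small` (unguarded edition on the small-field domain).
§3 translations on `ℤᵈ` (generic group ∕ algebra): `hol_translate`, `WZ_translate`, `smallZ_translate_iff`, `XZ_translate`, `bavgZ_translate`, `bavgZG_translate`
   (`x ↦ V(x+t)` at `q` = `V` at `q + t`).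
§4 `bavgZG_coverLift_translate_eq_avgFun ∕ bavgZ_coverLift_translate_eq_avgFun_of_small` (translated lifts), `coverAt_smul_add_ctrShift_succ` (THE base-point row:
   `π_j (L·w + (Lⁱ⁺¹−1)∕2·𝟙) = emb (π_{j+1} (w + (Lⁱ−1)∕2·𝟙))`), ★★★ `avgIterZG_coverLift_eq_iter` (for `k ≤ m+K`, ALL `j ≤ k`:
   `avgIterZG L δ_N (ι∘U∘π∘(· + (Lᵏ−1)∕2·𝟙)) j = fun w κ => ι(M^j(U) ⟨π_j(w + (L^{k−j}−1)∕2·𝟙), κ⟩)`, `M^j = Averaging.iter (fun _ => blockAvg expMeanLogSU) j`),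
   ★★ `avgIterZG_coverLift_eq_iter_top` (level `k`, shift-free: `… k w κ = ι(M^k(U) ⟨π_k w, κ⟩)`), `smallZ_avgIterZG_coverLift_iff_small` (the guard along the recursion =
   NODE 00's guard of `M^j(U)`), ★★ `avgIterZ_coverLift_eq_iter_of_small` (the UNGUARDED recursion the engine
   twins run on agrees level by level whenever every torus average `M^j(U)`, `j < k`, is inside NODE 00's guard at every coarse bond — the torus-side companion of
   `BlockAveragingZd.avgIterZG_eq_avgIterZ_of_small`, whose own hypothesis asks the guard at EVERY `ℤᵈ` base point, more than a torus run supplies).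
§5 the same three rows AT THE OBJECTS OF RECORD: `avgIterZG_coverLift_eq_iter_avOfRecord ∕ _top`, `avgIterZ_coverLift_eq_iter_avOfRecord_of_small`
   (`P := F.P K`, `Averaging.iter (avOfRecord F N K)`; `avOfRecord_apply` is `rfl`).
NOT HERE (successor rows of R7, on the LEAD PEN's R0b∕R0c names when they land): the gauge-FUNCTION block means (78)∕(81) `gaugeAvgIter (loopAvgBlockOp expMeanLogSU)` of
`NrmOfRecordWide` vs the transcription's `Restr129Rec`; the radial-axial rows (T3); the (152)∕(153) letters (this lineage's `TorusCoverLandau153*` doors, unchanged).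
HONEST FRAMING: kernel bookkeeping between two typings already in the tree — nothing of Bałaban asserted or discharged; `HThm4Rec` UNDISCHARGED (caveat (C-S3-1) stands);
N05-REC R1–R7 discharge nothing until the inhabitant of `HThm4RecEx` lands; N07 ∕ N05 NOT discharged, N07 NOT claimable on road (β); counts unmoved (typed 28∕28 · discharged
7∕28); one finite 𝕋⁴ programme at fixed ε — the route closes the conditional finite-𝕋⁴ rung `BalabanLadder.UV` ONLY; the YM mass gap (Clay) is NOT proved by any of this;
nothing continuum ∕ ℝ⁴ ∕ OS.  No `def`, no `sorry`, no `instance`, no `notation`.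

References: [I] (0.1) p. 251, (0.3)–(0.4) pp. 252–253, (0.11) p. 253; [3] (8)–(9) p. 18, (11) p. 19, (42)–(43) pp. 23–24; [B5] (1.7) p. 18.
-/

set_option autoImplicit false

noncomputable section

open scoped BigOperators Matrix.Norms.L2Operator

namespace Literature.MathematicalPhysics.QuantumFieldTheory.Balaban1983to89.Node00

open B15Eq112TorusCover (cover cover_apply)
open B14DomainGeom (Pt)
open T4Continuum (walk walkEnd holAt holAt_nil holAt_cons loopWord LStep)
open B7Prop1Explicit (e e_apply hol hol_nil hol_cons stepHol seg Letter)
open BlockAveragingZd (WZ SmallZ XZ bavgZ bavgZG avgIterZ avgIterZG offZ IdxZ ctrShift)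
open BlockAveraging (Idx off loopHol corr avgFun blockAvg)
open ExpMeanLog (expMeanLogSU deltaSU ESU eml)

variable {P : Params}

/-! ## §1  The level-`j` cover and the unit steps; holonomy of the cover lift -/

section Steps

/-- `π_j (x + e_μ) = (π_j x) + e_μ`: the level-`j` cover intertwines the forward unit steps. [cite: Balaban1987RG1, (0.1) p.251] -/
theorem coverAt_add_e (j : ℕ) (x : Pt P.d) (μ : Fin P.d) : coverAt P j (x + e μ) = (coverAt P j x).shift μ := by
  funext ν
  rw [Site.shift_apply]
  by_cases h : ν = μ
  · subst h; simp [coverAt_apply, e_apply]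
  · simp [coverAt_apply, e_apply, h]

/-- `π_j (x − e_μ) = (π_j x) − e_μ`: the level-`j` cover intertwines the backward unit steps. [cite: Balaban1987RG1, (0.1) p.251] -/
theorem coverAt_sub_e (j : ℕ) (x : Pt P.d) (μ : Fin P.d) : coverAt P j (x - e μ) = (coverAt P j x).unshift μ := by
  funext ν
  rw [Site.unshift_apply]
  by_cases h : ν = μ
  · subst h; simp [coverAt_apply, e_apply]
  · simp [coverAt_apply, e_apply, h]

variable {j : ℕ} {G : Type*} [GaugeGroup G]

/-- **HOLONOMY UNDER THE COVER LIFT**: the `ℤᵈ` parallel transport ([3] (9)) of the lifted configuration `V x μ = U ⟨π_j x, μ⟩` along ANY word from `x` IS the torus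
holonomy of the walk the word spells from `π_j x`. [cite: Balaban1985Averaging, (9) p.18; Balaban1987RG1, (0.1) p.251] -/
theorem hol_coverLift_eq_holAt_walk (U : GaugeField P j G) :
    ∀ (x : Pt P.d) (w : List (Letter P.d)),
      hol (fun y μ => U ⟨coverAt P j y, μ⟩) x w = holAt U (walk (coverAt P j x) w)
  | x, [] => by simp [walk, holAt_nil]
  | x, (μ, true) :: w => by
    rw [hol_cons, walk, holAt_cons, hol_coverLift_eq_holAt_walk U _ w]
    simp only [stepHol, if_true, Letter.vec, coverAt_add_e]
  | x, (μ, false) :: w => by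
    rw [hol_cons, walk, holAt_cons, hol_coverLift_eq_holAt_walk U _ w]
    have hv : Letter.vec ((μ, false) : Letter P.d) = -e μ := by simp [Letter.vec]
    simp only [stepHol, hv, ← sub_eq_add_neg, coverAt_sub_e, Bool.false_eq_true, if_false]

end Steps

section HolMap

variable {d : ℕ} {G H : Type*} [Group G] [Group H]

/-- Parallel transport (9) commutes with group homomorphisms applied bondwise: `hol (f ∘ V) = f (hol V)`. [cite: Balaban1985Averaging, (9) p.18] -/
theorem hol_map (f : G →* H) (V : B7Prop1Explicit.Site d → Fin d → G) :
    ∀ (x : B7Prop1Explicit.Site d) (w : List (Letter d)), hol (fun y μ => f (V y μ)) x w = f (hol V x w)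
  | x, [] => by simp
  | x, l :: w => by
    rw [hol_cons, hol_cons, map_mul, hol_map f V _ w]
    congr 1
    unfold stepHol
    split_ifs <;> simp [map_inv]

end HolMap

/-! ## §2  The record's loop variables, guard, coarse transporter and ONE-STEP (0.4) average under the cover lift -/

section OneStep

variable {j : ℕ} (N : ℕ) [NeZero N]

/-- The `SU(N)`-lift read through `ιSU`: `hol (ι ∘ U ∘ π_j) x w = ι (𝒰(walk (π_j x) w)(U))`. [cite: Balaban1985Averaging, (9) p.18; Balaban1987RG1, (0.1) p.251] -/
theorem hol_ιSU_coverLift (U : GaugeField P j (SU N)) (x : Pt P.d) (w : List (Letter P.d)) :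
    hol (fun y μ => ιSU N (U ⟨coverAt P j y, μ⟩)) x w = ιSU N (holAt U (walk (coverAt P j x) w)) := by
  rw [hol_map (ιSU N) (fun y μ => U ⟨coverAt P j y, μ⟩), hol_coverLift_eq_holAt_walk]

/-- **THE LOOP VARIABLES OF (0.4) UNDER THE COVER**: at a base point `q` of the cover over the centre `emb c₋` of the block of `c₋`, the `ℤᵈ` loop variable
`WZ` of the lift (index `i = (r, σ, σ′)`) IS the embedded torus loop variable `U(Γ ∪ [x,x′] ∪ (−Γ′) ∪ (−c))` of NODE 00's `BlockAveraging.loopHol`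
(same loop word, `offZ = off`, `IdxZ P.d P.L = Idx P` definitionally). [cite: Balaban1987RG1, (0.4) p.253] -/
theorem WZ_coverLift_eq_loopHol (U : GaugeField P j (SU N)) {q : Pt P.d} {c : PBond P (j + 1)} (hq : coverAt P j q = emb c.src) (i : Idx P) :
    WZ P.L (fun y μ => ιSU N (U ⟨coverAt P j y, μ⟩)) q c.dir i = ιSU N (loopHol U c i) := by
  rw [BlockAveragingZd.WZ_def, hol_ιSU_coverLift, hq]
  rfl

/-- **THE SMALL-FIELD GUARD UNDER THE COVER**: `SmallZ` of the lift at radius `δ_N = min(1∕3, π∕N)` at the base point over `emb c₋` ↔ NODE 00's `Small expMeanLogSU U c`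
(`dist1 = ‖· − 1‖` in the `L²`-operator norm on both sides). [cite: Balaban1987RG1, (0.4) p.253] -/
theorem smallZ_coverLift_iff_small (U : GaugeField P j (SU N)) {q : Pt P.d} {c : PBond P (j + 1)} (hq : coverAt P j q = emb c.src) :
    SmallZ P.L (deltaSU (Fin N)) (fun y μ => ιSU N (U ⟨coverAt P j y, μ⟩)) q c.dir ↔ BlockAveraging.Small expMeanLogSU U c := by
  unfold SmallZ BlockAveraging.Small
  refine forall_congr' fun i => ?_
  rw [WZ_coverLift_eq_loopHol N U hq i]
  rfl

/-- **THE COARSE BOND VARIABLE UNDER THE COVER**: the straight transporter `V([q, q + Le_κ])` of the lift IS the embedded axial average `U(c)` ([B5] (1.7); NODE 00's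
`AveragingRT.axialAvg`). [cite: Balaban1987RG1, (0.4) p.253; Balaban1984PropagatorsI, (1.7) p.18] -/
theorem hol_seg_coverLift_eq_axialAvg (U : GaugeField P j (SU N)) {q : Pt P.d} {c : PBond P (j + 1)} (hq : coverAt P j q = emb c.src) :
    hol (fun y μ => ιSU N (U ⟨coverAt P j y, μ⟩)) q (seg c.dir P.L) = ιSU N (AveragingRT.axialAvg U c) := by
  rw [hol_ιSU_coverLift, hq, T4Continuum.axialAvg_eq_holAt_walk, B7Prop1Explicit.seg_natCast]

/-- The exponent of (0.4) under the cover: `XZ` of the lift at the base point over `emb c₋` is the uniform mean of the logarithms of NODE 00's loop variables.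
[cite: Balaban1987RG1, (0.4) p.253] -/
theorem XZ_coverLift_eq (U : GaugeField P j (SU N)) {q : Pt P.d} {c : PBond P (j + 1)} (hq : coverAt P j q = emb c.src) :
    XZ P.L (fun y μ => ιSU N (U ⟨coverAt P j y, μ⟩)) q c.dir =
      ∑ i : Idx P, ((Fintype.card (Idx P) : ℝ))⁻¹ • MatrixLog.mlog ((loopHol U c i : SU N) : MatA N) := by
  unfold XZ
  refine Finset.sum_congr rfl fun i _ => ?_
  rw [WZ_coverLift_eq_loopHol N U hq i]
  rfl

/-- On the guard, NODE 00's inner operation `expMeanLogSU.avg` of the loop family is the printed `exp[Σ_i |I|⁻¹ log W_i]` over the WHOLE index type (the fixed enumeration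
`LoopAverage.enum` reindexes a uniform mean). [cite: Balaban1987RG1, (0.4)∕(0.7) p.253] -/
theorem coe_expMeanLogSU_avg_of_small {ι : Type*} [Fintype ι] [Nonempty ι] (W : ι → SU N) (hW : ∀ i, dist1 (W i) < deltaSU (Fin N)) :
    (((expMeanLogSU (n := Fin N)).avg W : SU N) : MatA N) = NormedSpace.exp (∑ i, ((Fintype.card ι : ℝ))⁻¹ • MatrixLog.mlog ((W i : SU N) : MatA N)) := by
  have hW' : ∀ k, ‖(((W ∘ (LoopAverage.enum ι).symm) k : SU N) : MatA N) - 1‖ < deltaSU (Fin N) := fun k => hW _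
  show ((ESU (W ∘ (LoopAverage.enum ι).symm) : SU N) : MatA N) = _
  rw [ExpMeanLog.coe_ESU_of_small hW', ExpMeanLog.eml_eq_exp_sum]
  have hc : Fintype.card (Fin (Fintype.card ι - 1 + 1)) = Fintype.card ι := by
    rw [Fintype.card_fin, Nat.sub_add_cancel Fintype.card_pos]
  rw [hc]
  exact congrArg _ (Fintype.sum_equiv (LoopAverage.enum ι).symm _ _ fun k => rfl)

/-- ★ **THE ONE-STEP (0.4) AVERAGE OF RECORD UNDER THE COVER** — the GUARDED `ℤᵈ` transcription `bavgZG` at radius `δ_N` of the lift, at the base point over `emb c₋`, IS the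
embedded value of NODE 00's total block averaging `avgFun expMeanLogSU U c` (= `avOfRecord`'s map): on the guard `exp[XZ]·V([q,q+Le_κ]) = E{loop variables}·U(c)`, off it both are
the axial transporter. [cite: Balaban1987RG1, (0.4) p.253] -/
theorem bavgZG_coverLift_eq_avgFun (U : GaugeField P j (SU N)) {q : Pt P.d} {c : PBond P (j + 1)} (hq : coverAt P j q = emb c.src) :
    bavgZG P.L (deltaSU (Fin N)) (fun y μ => ιSU N (U ⟨coverAt P j y, μ⟩)) q c.dir = ιSU N (avgFun expMeanLogSU U c) := by
  classical
  unfold bavgZG avgFun corr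
  by_cases h : BlockAveraging.Small expMeanLogSU U c
  · rw [if_pos ((smallZ_coverLift_iff_small N U hq).mpr h), if_pos h, map_mul, hol_seg_coverLift_eq_axialAvg N U hq]
    congr 1
    apply Units.ext
    rw [B7Prop1Explicit.val_expUnit, XZ_coverLift_eq N U hq, coe_ιSU, coe_expMeanLogSU_avg_of_small N (loopHol U c) h]
  · rw [if_neg (fun h' => h ((smallZ_coverLift_iff_small N U hq).mp h')), if_neg h, one_mul, one_mul,
      hol_seg_coverLift_eq_axialAvg N U hq]

/-- On the small-field domain the UNGUARDED transcription `bavgZ` (the edition the engine's analysis runs on) has the same value. [cite: Balaban1987RG1, (0.4) p.253] -/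
theorem bavgZ_coverLift_eq_avgFun_of_small (U : GaugeField P j (SU N)) {q : Pt P.d} {c : PBond P (j + 1)} (hq : coverAt P j q = emb c.src)
    (h : BlockAveraging.Small expMeanLogSU U c) :
    bavgZ P.L (fun y μ => ιSU N (U ⟨coverAt P j y, μ⟩)) q c.dir = ιSU N (avgFun expMeanLogSU U c) := by
  rw [← BlockAveragingZd.bavgZG_eq_bavgZ_of_small P.L ((smallZ_coverLift_iff_small N U hq).mpr h), bavgZG_coverLift_eq_avgFun N U hq]

end OneStep

/-! ## §3  Translations on `ℤᵈ`: the (0.4) objects of a translated configuration are the objects at the translated base point -/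

section Translate

variable {d : ℕ} (L : ℕ)

/-- Parallel transport of the translated configuration `x ↦ V(x + t)` from `x` is parallel transport of `V` from `x + t`. [cite: Balaban1985Averaging, (9) p.18] -/
theorem hol_translate {G : Type*} [Group G] (V : B7Prop1Explicit.Site d → Fin d → G) (t : B7Prop1Explicit.Site d) :
    ∀ (x : B7Prop1Explicit.Site d) (w : List (Letter d)), hol (fun y μ => V (y + t) μ) x w = hol V (x + t) w
  | x, [] => by simp
  | x, l :: w => by
    rw [hol_cons, hol_cons, hol_translate V t _ w, add_right_comm]
    congr 1
    unfold stepHol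
    split_ifs <;> simp [add_right_comm]

/-- The loop variables (0.4) of the translated configuration. [cite: Balaban1987RG1, (0.4) p.253] -/
theorem WZ_translate {G : Type*} [Group G] (V : B7Prop1Explicit.Site d → Fin d → G) (t q : B7Prop1Explicit.Site d) (κ : Fin d) (i : IdxZ d L) :
    WZ L (fun y μ => V (y + t) μ) q κ i = WZ L V (q + t) κ i := by
  rw [BlockAveragingZd.WZ_def, BlockAveragingZd.WZ_def, hol_translate]

variable {𝔸 : Type*} [NormedRing 𝔸]

/-- The guard (0.4) of the translated configuration. [cite: Balaban1987RG1, (0.4) p.253] -/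
theorem smallZ_translate_iff (δ : ℝ) (V : B7Prop1Explicit.Site d → Fin d → 𝔸ˣ) (t q : B7Prop1Explicit.Site d) (κ : Fin d) :
    SmallZ L δ (fun y μ => V (y + t) μ) q κ ↔ SmallZ L δ V (q + t) κ := by
  unfold SmallZ
  simp only [WZ_translate]

variable [NormedAlgebra ℂ 𝔸]

/-- The exponent of (0.4) of the translated configuration. [cite: Balaban1987RG1, (0.4) p.253] -/
theorem XZ_translate (V : B7Prop1Explicit.Site d → Fin d → 𝔸ˣ) (t q : B7Prop1Explicit.Site d) (κ : Fin d) :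
    XZ L (fun y μ => V (y + t) μ) q κ = XZ L V (q + t) κ := by
  unfold XZ
  simp only [WZ_translate]

variable [CompleteSpace 𝔸]

/-- The unguarded (0.4) average of the translated configuration. [cite: Balaban1987RG1, (0.4) p.253] -/
theorem bavgZ_translate (V : B7Prop1Explicit.Site d → Fin d → 𝔸ˣ) (t q : B7Prop1Explicit.Site d) (κ : Fin d) :
    bavgZ L (fun y μ => V (y + t) μ) q κ = bavgZ L V (q + t) κ := by
  rw [BlockAveragingZd.bavgZ_apply, BlockAveragingZd.bavgZ_apply, XZ_translate, hol_translate]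

/-- The guarded (0.4) average (the record's) of the translated configuration. [cite: Balaban1987RG1, (0.4) p.253] -/
theorem bavgZG_translate (δ : ℝ) (V : B7Prop1Explicit.Site d → Fin d → 𝔸ˣ) (t q : B7Prop1Explicit.Site d) (κ : Fin d) :
    bavgZG L δ (fun y μ => V (y + t) μ) q κ = bavgZG L δ V (q + t) κ := by
  classical
  unfold bavgZG
  rw [XZ_translate, hol_translate]
  simp only [smallZ_translate_iff]

end Translate

/-! ## §4  The `k`-fold (0.4) average of record under the cover: TOP-ANCHORED identification with NODE 00's `Averaging.iter (blockAvg expMeanLogSU)` -/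

section Iterated

variable {j : ℕ} (N : ℕ) [NeZero N]

/-- The one-step identification of §2 for a TRANSLATED lift `x ↦ ι(U⟨π_j(x + t), μ⟩)`: at any base point `q` with `π_j (q + t) = emb c₋`, the guarded transcription is the embedded
one-step average of record. [cite: Balaban1987RG1, (0.4) p.253] -/
theorem bavgZG_coverLift_translate_eq_avgFun (U : GaugeField P j (SU N)) (t : Pt P.d) {q : Pt P.d} {c : PBond P (j + 1)} (hq : coverAt P j (q + t) = emb c.src) :
    bavgZG P.L (deltaSU (Fin N)) (fun y μ => ιSU N (U ⟨coverAt P j (y + t), μ⟩)) q c.dir = ιSU N (avgFun expMeanLogSU U c) := by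
  rw [← bavgZG_coverLift_eq_avgFun N U hq, ← bavgZG_translate]

/-- The same for the unguarded transcription on the small-field domain. [cite: Balaban1987RG1, (0.4) p.253] -/
theorem bavgZ_coverLift_translate_eq_avgFun_of_small (U : GaugeField P j (SU N)) (t : Pt P.d) {q : Pt P.d} {c : PBond P (j + 1)}
    (hq : coverAt P j (q + t) = emb c.src) (h : BlockAveraging.Small expMeanLogSU U c) :
    bavgZ P.L (fun y μ => ιSU N (U ⟨coverAt P j (y + t), μ⟩)) q c.dir = ιSU N (avgFun expMeanLogSU U c) := by
  rw [← bavgZ_coverLift_eq_avgFun_of_small N U hq h, ← bavgZ_translate]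

/-- **THE BASE-POINT ROW OF THE INDUCTION** (`L` odd; standing range `j + 1 ≤ m + K`): the `ℤᵈ` recursion (43) evaluates the level-`j` average at `L·w`; with the
level-`j` lift anchored at the centre shift `(Lⁱ⁺¹ − 1)∕2` and the level-`(j+1)` lift at `(Lⁱ − 1)∕2`, `π_j (L·w + (Lⁱ⁺¹−1)∕2·𝟙) = emb (π_{j+1} (w + (Lⁱ−1)∕2·𝟙))` —
NODE 00's centre embedding `emb y = L·y + (L−1)∕2` (`emb_coverAt`) and the nesting of centres `ctrShift_succ`. [cite: Balaban1987RG1, (0.1) p.251, (0.3) p.252] -/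
theorem coverAt_smul_add_ctrShift_succ (hj : j + 1 ≤ P.m + P.K) (i : ℕ) (w : Pt P.d) :
    coverAt P j ((P.L : ℤ) • w + fun _ => ((ctrShift P.L (i + 1) : ℕ) : ℤ)) =
      emb (coverAt P (j + 1) (w + fun _ => ((ctrShift P.L i : ℕ) : ℤ))) := by
  rw [emb_coverAt hj, BlockAveragingZd.ctrShift_succ P.hL.1 i]
  congr 1
  funext μ
  simp only [Pi.add_apply, Pi.smul_apply, smul_eq_mul]
  push_cast
  ring

/-- ★★ **THE `k`-FOLD (0.4) AVERAGE OF RECORD UNDER THE COVER, TOP-ANCHORED** ([I] (0.11) `Ū^j = M^j(U)`; the DICTIONARY row «`avgIterZG ↔ Averaging.iter (avOfRecord F N K)`»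
of the `ℤᵈ` transcription): for `k ≤ m + K` and the lift of the finest torus field anchored at the level-`k` centre shift, `V x μ := ι(U⟨π(x + (Lᵏ−1)∕2·𝟙), μ⟩)`, EVERY level
`j ≤ k` of the guarded `ℤᵈ` recursion `avgIterZG` (radius `δ_N`) IS the embedded `j`-fold block average of record read through the level-`j` cover anchored at `(L^{k−j}−1)∕2·𝟙`:
`Ū^j_{ℤᵈ}(w, κ) = ι( M^j(U) ⟨π_j(w + (L^{k−j}−1)∕2·𝟙), κ⟩ )`.  The anchoring is the `ℤᵈ` transcription's (level-`k` blocks CENTRED at `Lᵏz`) against NODE 00's (`emb`, blocks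
centred at `Lᵏz + (Lᵏ−1)∕2`). [cite: Balaban1987RG1, (0.4) p.253, (0.11) p.253; Balaban1985Averaging, (43) p.24] -/
theorem avgIterZG_coverLift_eq_iter {k : ℕ} (hk : k ≤ P.m + P.K) (U : GaugeField P 0 (SU N)) :
    ∀ j, j ≤ k →
      avgIterZG P.L (deltaSU (Fin N)) (fun x μ => ιSU N (U ⟨cover P (x + fun _ => ((ctrShift P.L k : ℕ) : ℤ)), μ⟩)) j =
        fun w κ => ιSU N (Averaging.iter (fun _ => blockAvg expMeanLogSU) j U
          ⟨coverAt P j (w + fun _ => ((ctrShift P.L (k - j) : ℕ) : ℤ)), κ⟩)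
  | 0, _ => rfl
  | j + 1, hj => by
    have hj' : j ≤ k := Nat.le_of_succ_le hj
    have hkj : k - j = (k - (j + 1)) + 1 := by omega
    funext w κ
    rw [BlockAveragingZd.avgIterZG_succ, avgIterZG_coverLift_eq_iter hk U j hj', B7Prop2Explicit.rescale_apply, hkj]
    exact bavgZG_coverLift_translate_eq_avgFun N (Averaging.iter (fun _ => blockAvg expMeanLogSU) j U) _
      (c := ⟨coverAt P (j + 1) (w + fun _ => ((ctrShift P.L (k - (j + 1)) : ℕ) : ℤ)), κ⟩)
      (coverAt_smul_add_ctrShift_succ (hj.trans hk) (k - (j + 1)) w)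

/-- ★★ **THE TOP LEVEL, SHIFT-FREE**: `Ū^k_{ℤᵈ}(w, κ) = ι( M^k(U) ⟨π_k w, κ⟩ )` for the lift anchored at `(Lᵏ−1)∕2·𝟙`. [cite: Balaban1987RG1, (0.4) p.253, (0.11) p.253] -/
theorem avgIterZG_coverLift_eq_iter_top {k : ℕ} (hk : k ≤ P.m + P.K) (U : GaugeField P 0 (SU N)) (w : Pt P.d) (κ : Fin P.d) :
    avgIterZG P.L (deltaSU (Fin N)) (fun x μ => ιSU N (U ⟨cover P (x + fun _ => ((ctrShift P.L k : ℕ) : ℤ)), μ⟩)) k w κ =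
      ιSU N (Averaging.iter (fun _ => blockAvg expMeanLogSU) k U ⟨coverAt P k w, κ⟩) := by
  have h0 : (w + fun _ => ((ctrShift P.L (k - k) : ℕ) : ℤ)) = w := by
    funext μ
    simp [BlockAveragingZd.ctrShift]
  rw [avgIterZG_coverLift_eq_iter N hk U k le_rfl]
  simp only [h0]

/-- **THE GUARD ALONG THE RECURSION**: at the base points `L·w` where (43) evaluates the level-`j` average (`j < k`), the transcription's guard `SmallZ` (radius `δ_N`) of the
`j`-th iterate IS NODE 00's guard `Small expMeanLogSU` of the torus average `M^j(U)` at the coarse bond over `π_{j+1}(w + (L^{k−j−1}−1)∕2·𝟙)`. [cite: Balaban1987RG1, (0.4) p.253, (0.11) p.253] -/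
theorem smallZ_avgIterZG_coverLift_iff_small {k : ℕ} (hk : k ≤ P.m + P.K) (U : GaugeField P 0 (SU N)) {j : ℕ} (hj : j < k) (w : Pt P.d) (κ : Fin P.d) :
    SmallZ P.L (deltaSU (Fin N)) (avgIterZG P.L (deltaSU (Fin N)) (fun x μ => ιSU N (U ⟨cover P (x + fun _ => ((ctrShift P.L k : ℕ) : ℤ)), μ⟩)) j)
        ((P.L : ℤ) • w) κ ↔
      BlockAveraging.Small expMeanLogSU (Averaging.iter (fun _ => blockAvg expMeanLogSU) j U)
        ⟨coverAt P (j + 1) (w + fun _ => ((ctrShift P.L (k - (j + 1)) : ℕ) : ℤ)), κ⟩ := by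
  have hkj : k - j = (k - (j + 1)) + 1 := by omega
  rw [avgIterZG_coverLift_eq_iter N hk U j hj.le, hkj]
  exact (smallZ_translate_iff P.L (deltaSU (Fin N))
      (fun y μ => ιSU N (Averaging.iter (fun _ => blockAvg expMeanLogSU) j U ⟨coverAt P j y, μ⟩))
      (fun _ => ((ctrShift P.L (k - (j + 1) + 1) : ℕ) : ℤ)) ((P.L : ℤ) • w) κ).trans
    (smallZ_coverLift_iff_small N _ (c := ⟨coverAt P (j + 1) (w + fun _ => ((ctrShift P.L (k - (j + 1)) : ℕ) : ℤ)), κ⟩)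
      (coverAt_smul_add_ctrShift_succ (Nat.le_trans hj hk) (k - (j + 1)) w))

/-- ★ **THE UNGUARDED EDITION ON THE SMALL-FIELD DOMAIN OF RECORD**: if every intermediate torus average `M^j(U)`, `j < k`, is inside the (0.4) guard at every coarse bond (NODE 00's
`Small expMeanLogSU`), then the UNGUARDED `ℤᵈ` recursion `avgIterZ` (the edition the [3]∕[6] engine twins run on) coincides level by level with the embedded averages of record — the
torus-side companion of `BlockAveragingZd.avgIterZG_eq_avgIterZ_of_small`. [cite: Balaban1987RG1, (0.4) p.253, (0.11) p.253; Balaban1985Averaging, (43) p.24] -/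
theorem avgIterZ_coverLift_eq_iter_of_small {k : ℕ} (hk : k ≤ P.m + P.K) (U : GaugeField P 0 (SU N))
    (hs : ∀ j, j < k → ∀ c : PBond P (j + 1), BlockAveraging.Small expMeanLogSU (Averaging.iter (fun _ => blockAvg expMeanLogSU) j U) c) :
    ∀ j, j ≤ k →
      avgIterZ P.L (fun x μ => ιSU N (U ⟨cover P (x + fun _ => ((ctrShift P.L k : ℕ) : ℤ)), μ⟩)) j =
        fun w κ => ιSU N (Averaging.iter (fun _ => blockAvg expMeanLogSU) j U
          ⟨coverAt P j (w + fun _ => ((ctrShift P.L (k - j) : ℕ) : ℤ)), κ⟩)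
  | 0, _ => rfl
  | j + 1, hj => by
    have hj' : j ≤ k := Nat.le_of_succ_le hj
    have hkj : k - j = (k - (j + 1)) + 1 := by omega
    funext w κ
    rw [BlockAveragingZd.avgIterZ_succ, avgIterZ_coverLift_eq_iter_of_small hk U hs j hj', B7Prop2Explicit.rescale_apply, hkj]
    exact bavgZ_coverLift_translate_eq_avgFun_of_small N (Averaging.iter (fun _ => blockAvg expMeanLogSU) j U) _
      (c := ⟨coverAt P (j + 1) (w + fun _ => ((ctrShift P.L (k - (j + 1)) : ℕ) : ℤ)), κ⟩)
      (coverAt_smul_add_ctrShift_succ (hj.trans hk) (k - (j + 1)) w) (hs j (Nat.lt_of_succ_le hj) _)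

end Iterated

/-! ## §5  The reading at the objects of record: `Averaging.iter (avOfRecord F N K)` on the torus `F.P K` -/

section Record

open T4Continuum (T4Family)

variable (F : T4Family) (N : ℕ) [NeZero N]

/-- ★★ **`avgIterZG ↔ Averaging.iter (avOfRecord F N K)`** (the dictionary row of the `ℤᵈ` transcription AT THE OBJECTS OF RECORD): on the `K`-th torus `F.P K`, for `k ≤ m + K`, every
level `j ≤ k` of the guarded `ℤᵈ` recursion of the top-anchored lift is the embedded `j`-fold average of record `M^j(U) = Averaging.iter (avOfRecord F N K) j U` read through the
level-`j` cover anchored at `(L^{k−j}−1)∕2·𝟙` (`avOfRecord F N K j = blockAvg expMeanLogSU`, `DatumAvLayer.avOfRecord_apply`). [cite: Balaban1987RG1, (0.4) p.253, (0.11) p.253] -/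
theorem avgIterZG_coverLift_eq_iter_avOfRecord {K k : ℕ} (hk : k ≤ (F.P K).m + (F.P K).K) (U : GaugeField (F.P K) 0 (SU N)) (j : ℕ) (hj : j ≤ k) :
    avgIterZG (F.P K).L (deltaSU (Fin N)) (fun x μ => ιSU N (U ⟨cover (F.P K) (x + fun _ => ((ctrShift (F.P K).L k : ℕ) : ℤ)), μ⟩)) j =
      fun w κ => ιSU N (Averaging.iter (avOfRecord F N K) j U
        ⟨coverAt (F.P K) j (w + fun _ => ((ctrShift (F.P K).L (k - j) : ℕ) : ℤ)), κ⟩) :=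
  avgIterZG_coverLift_eq_iter N hk U j hj

/-- The top level at the objects of record, shift-free: `Ū^k_{ℤᵈ}(w, κ) = ι( (Averaging.iter (avOfRecord F N K) k U) ⟨π_k w, κ⟩ )`. [cite: Balaban1987RG1, (0.4) p.253, (0.11) p.253] -/
theorem avgIterZG_coverLift_eq_iter_avOfRecord_top {K k : ℕ} (hk : k ≤ (F.P K).m + (F.P K).K) (U : GaugeField (F.P K) 0 (SU N)) (w : Pt (F.P K).d) (κ : Fin (F.P K).d) :
    avgIterZG (F.P K).L (deltaSU (Fin N)) (fun x μ => ιSU N (U ⟨cover (F.P K) (x + fun _ => ((ctrShift (F.P K).L k : ℕ) : ℤ)), μ⟩)) k w κ =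
      ιSU N (Averaging.iter (avOfRecord F N K) k U ⟨coverAt (F.P K) k w, κ⟩) :=
  avgIterZG_coverLift_eq_iter_top N hk U w κ

/-- The unguarded edition at the objects of record, on the small-field domain of the run. [cite: Balaban1987RG1, (0.4) p.253, (0.11) p.253] -/
theorem avgIterZ_coverLift_eq_iter_avOfRecord_of_small {K k : ℕ} (hk : k ≤ (F.P K).m + (F.P K).K) (U : GaugeField (F.P K) 0 (SU N))
    (hs : ∀ j, j < k → ∀ c : PBond (F.P K) (j + 1), BlockAveraging.Small expMeanLogSU (Averaging.iter (avOfRecord F N K) j U) c) (j : ℕ) (hj : j ≤ k) :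
    avgIterZ (F.P K).L (fun x μ => ιSU N (U ⟨cover (F.P K) (x + fun _ => ((ctrShift (F.P K).L k : ℕ) : ℤ)), μ⟩)) j =
      fun w κ => ιSU N (Averaging.iter (avOfRecord F N K) j U
        ⟨coverAt (F.P K) j (w + fun _ => ((ctrShift (F.P K).L (k - j) : ℕ) : ℤ)), κ⟩) :=
  avgIterZ_coverLift_eq_iter_of_small N hk U hs j hj

end Record

end Literature.MathematicalPhysics.QuantumFieldTheory.Balaban1983to89.Node00

end
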